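import Summits.ValiantsHypothesis.ValiantsHypothesis.Theorems.LacunarySymmetroidMatrixDescartesWLawTwoRankOneMiddle

/-!
# `MatrixDescartes` (stmt-ValiantsHypothesis-18050) — the W-law at `n = 2`: the COEFFICIENT TABLE of the W-determinant in the
# open chamber, and the LEVER in coefficient currency

HONEST FRAMING.  Cell `pub-symmetroid`, seat `val-sym-mdr-p2` (gen 6); helper `--supports` the crux
`Theses.LacunarySymmetroid.MatrixDescartes` (OPEN), NO closure claim.  Object: the typed W-law `WLawAt 2 6` (`…WLawDefs`) for `2 × 2`
W-configurations `F = X^e J + X^{d₁} P₁ + X^{d₂} P₂ + X^{d₃} Q` (`d₂ < d₁ < e < d₃`).  After the CHAMBER LAW (val-sym-mdr-p1 g4), the SIGN-CELL LAW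
and the RANK-ONE-MIDDLE LAW (this seat, `…WLawTwoSignCell`, `…WLawTwoRankOneMiddle`) the undecided core is: exponents in the chamber
`e + d₂ < 2d₁ ∧ d₁ + e < d₂ + d₃ ∧ d₂ + d₃ < 2e`, `det J < 0`, all `mix(J,·) < 0`, `det P₁ > 0` — where signs allow `8` and every further
step is a MAGNITUDE argument on the ten coefficients.  This file supplies the dictionary such an argument needs, in the kernel:

* `coeff_table` (ten statements `coeff_*`): **inside the chamber the ten degrees `2d₂ < d₁+d₂ < e+d₂ < 2d₁ < e+d₁ < d₂+d₃ < 2e <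
  d₁+d₃ < e+d₃ < 2d₃` are pairwise distinct, each is hit by exactly one unordered pair of letters, and the coefficient of `det F` there is
  `det P₂, mix(P₁,P₂), mix(J,P₂), det P₁, mix(J,P₁), mix(P₂,Q), det J, mix(P₁,Q), mix(J,Q), det Q` respectively**
  (`mix(X,Y) = X₀₀Y₁₁ + Y₀₀X₁₁ − X₀₁Y₁₀ − Y₀₁X₁₀`, the polarised determinant; `J` any real matrix, the letters any real matrices — no
  symmetry or positivity is used for the table itself);
* `lever_coeff` — **the LEVER in coefficient currency: `coeff(2d₁) · coeff(d₂+d₃) ≤ coeff(d₁+d₂) · coeff(d₁+d₃)`** for `P₁` symmetric and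
  `P₂, Q ⪰ 0` (from `WLawTwoSignCell.lever`), i.e. among the four POSITIVE coefficients at `2d₁ < d₂+d₃` (inner) and `d₁+d₂ < d₁+d₃`
  (outer, `(d₁+d₂) + (d₁+d₃) = 2d₁ + (d₂+d₃)`) the inner product is dominated by the outer one — the anti-Newton relation that forbids
  the two separators `X^{2d₁}`, `X^{d₂+d₃}` of the three lowest negative pivot terms from both dominating (tropically: no 8-pattern);
* `newton_coeff_low`, `newton_coeff_high` — the two Newton-like companions `coeff(2d₂)·coeff(d₁+d₃) ≤ coeff(d₁+d₂)·coeff(d₂+d₃)` and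
  `coeff(2d₃)·coeff(d₁+d₂) ≤ coeff(d₂+d₃)·coeff(d₁+d₃)` (same identity with `P₂`, resp. `Q`, as the sandwich).

Nothing here decides the core, and nothing bears on `WLaw` for `n ≥ 3`, on `MatrixDescartes` / `stub_twoSided` in its window, on
`DoorA26` / `DoorA34`, registers, or `VP ≠ VNP`.

[folklore] Coefficient bookkeeping of `2 × 2` pencils (tree `Pivot.TwoDescartes.coeff_det`); no source.
-/

-- `Summit.ValiantsHypothesis.ValiantsHypothesis.…` repeats a component by the D-0017 layout
-- (single-conjunct summit), which the `dupNamespace` linter flags; the name is mandated.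
set_option linter.dupNamespace false

namespace Summit.ValiantsHypothesis.ValiantsHypothesis.Theorems.LacunarySymmetroidMatrixDescartes

open Polynomial Finset
open scoped BigOperators

namespace WLawTwoCoefficients

open Pivot.TwoDescartes (letter expo agg coeff_det agg_eq_zero psd_two_facts)
open WLawTwoChambers (expo_w_cases)

variable {e d₁ d₂ d₃ : ℕ} {J P₁ P₂ Q : Matrix (Fin 2) (Fin 2) ℝ}

/-! ## 1. The aggregated letters of the W-pencil -/

/-- Evaluation of the aggregated letter of the W-pencil at the four letter exponents. -/
theorem agg_w (h₂₁ : d₂ < d₁) (h₁ₑ : d₁ < e) (hₑ₃ : e < d₃) :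
    agg e ![d₁, d₂, d₃] J ![P₁, P₂, Q] d₂ = P₂ ∧ agg e ![d₁, d₂, d₃] J ![P₁, P₂, Q] d₁ = P₁ ∧
      agg e ![d₁, d₂, d₃] J ![P₁, P₂, Q] e = J ∧ agg e ![d₁, d₂, d₃] J ![P₁, P₂, Q] d₃ = Q := by
  refine ⟨?_, WLawTwoRankOneMiddle.agg_d₁ h₂₁ h₁ₑ hₑ₃, ?_, ?_⟩
  · unfold agg
    rw [Fintype.sum_option, Fin.sum_univ_three]
    have h0 : (if expo e ![d₁, d₂, d₃] none = d₂ then letter J ![P₁, P₂, Q] none else 0) = 0 :=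
      if_neg (fun h => absurd (show e = d₂ from h) (by omega))
    have h1 : (if expo e ![d₁, d₂, d₃] (some 0) = d₂ then letter J ![P₁, P₂, Q] (some 0) else 0) = 0 :=
      if_neg (fun h => absurd (show d₁ = d₂ by simpa [expo] using h) (by omega))
    have h2 : (if expo e ![d₁, d₂, d₃] (some 1) = d₂ then letter J ![P₁, P₂, Q] (some 1) else 0) = P₂ :=
      if_pos (by simp [expo])
    have h3 : (if expo e ![d₁, d₂, d₃] (some 2) = d₂ then letter J ![P₁, P₂, Q] (some 2) else 0) = 0 :=
      if_neg (fun h => absurd (show d₃ = d₂ by simpa [expo] using h) (by omega))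
    rw [h0, h1, h2, h3]
    simp
  · exact WLawTwoSignCell.agg_pivot e ![d₁, d₂, d₃] J ![P₁, P₂, Q] (fun k => by fin_cases k <;> simp <;> omega)
  · unfold agg
    rw [Fintype.sum_option, Fin.sum_univ_three]
    have h0 : (if expo e ![d₁, d₂, d₃] none = d₃ then letter J ![P₁, P₂, Q] none else 0) = 0 :=
      if_neg (fun h => absurd (show e = d₃ from h) (by omega))
    have h1 : (if expo e ![d₁, d₂, d₃] (some 0) = d₃ then letter J ![P₁, P₂, Q] (some 0) else 0) = 0 :=
      if_neg (fun h => absurd (show d₁ = d₃ by simpa [expo] using h) (by omega))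
    have h2 : (if expo e ![d₁, d₂, d₃] (some 1) = d₃ then letter J ![P₁, P₂, Q] (some 1) else 0) = 0 :=
      if_neg (fun h => absurd (show d₂ = d₃ by simpa [expo] using h) (by omega))
    have h3 : (if expo e ![d₁, d₂, d₃] (some 2) = d₃ then letter J ![P₁, P₂, Q] (some 2) else 0) = Q :=
      if_pos (by simp [expo])
    rw [h0, h1, h2, h3]
    simp

/-! ## 2. Generic coefficient extraction: a degree hit by exactly one unordered pair of letter exponents -/

/-- **Square degrees.**  If `a₀ + a₀ = n` and every pair of letter exponents summing to `n` is `(a₀, a₀)`, then the coefficient of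
`Xⁿ` in `det F` is `det (agg a₀)`. -/
theorem coeff_eq_square (n a₀ : ℕ) (hn : a₀ + a₀ = n)
    (huniq : ∀ l l' : Option (Fin 3), expo e ![d₁, d₂, d₃] l + expo e ![d₁, d₂, d₃] l' = n →
      expo e ![d₁, d₂, d₃] l = a₀ ∧ expo e ![d₁, d₂, d₃] l' = a₀) :
    (Matrix.det (∑ l, ((X : ℝ[X]) ^ expo e ![d₁, d₂, d₃] l) • (letter J ![P₁, P₂, Q] l).map Polynomial.C)).coeff n
      = (agg e ![d₁, d₂, d₃] J ![P₁, P₂, Q] a₀).det := by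
  rw [coeff_det, Finset.sum_eq_single (a₀, a₀)]
  · simp only
    rw [Matrix.det_fin_two]
  · rintro ⟨a, b⟩ hab hne
    have hab' : a + b = n := by simpa using hab
    simp only
    by_cases ha : ∃ l, expo e ![d₁, d₂, d₃] l = a
    · obtain ⟨l, hl⟩ := ha
      by_cases hb : ∃ l', expo e ![d₁, d₂, d₃] l' = b
      · obtain ⟨l', hl'⟩ := hb
        have h := huniq l l' (by rw [hl, hl', hab'])
        exact absurd (Prod.ext (hl.symm.trans h.1) (hl'.symm.trans h.2)) hne
      · push Not at hb
        rw [agg_eq_zero e _ J _ b hb]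
        simp
    · push Not at ha
      rw [agg_eq_zero e _ J _ a ha]
      simp
  · intro h
    exact absurd (by rw [Finset.HasAntidiagonal.mem_antidiagonal]; exact hn) h

/-- **Cross degrees.**  If `a₀ + b₀ = n`, `a₀ ≠ b₀`, and every pair of letter exponents summing to `n` is `(a₀, b₀)` or `(b₀, a₀)`,
then the coefficient of `Xⁿ` in `det F` is the polarised determinant `mix(agg a₀, agg b₀)`. -/
theorem coeff_eq_pair (n a₀ b₀ : ℕ) (hn : a₀ + b₀ = n) (hne₀ : a₀ ≠ b₀)
    (huniq : ∀ l l' : Option (Fin 3), expo e ![d₁, d₂, d₃] l + expo e ![d₁, d₂, d₃] l' = n →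
      (expo e ![d₁, d₂, d₃] l = a₀ ∧ expo e ![d₁, d₂, d₃] l' = b₀) ∨
        (expo e ![d₁, d₂, d₃] l = b₀ ∧ expo e ![d₁, d₂, d₃] l' = a₀)) :
    (Matrix.det (∑ l, ((X : ℝ[X]) ^ expo e ![d₁, d₂, d₃] l) • (letter J ![P₁, P₂, Q] l).map Polynomial.C)).coeff n
      = agg e ![d₁, d₂, d₃] J ![P₁, P₂, Q] a₀ 0 0 * agg e ![d₁, d₂, d₃] J ![P₁, P₂, Q] b₀ 1 1
        + agg e ![d₁, d₂, d₃] J ![P₁, P₂, Q] b₀ 0 0 * agg e ![d₁, d₂, d₃] J ![P₁, P₂, Q] a₀ 1 1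
        - agg e ![d₁, d₂, d₃] J ![P₁, P₂, Q] a₀ 0 1 * agg e ![d₁, d₂, d₃] J ![P₁, P₂, Q] b₀ 1 0
        - agg e ![d₁, d₂, d₃] J ![P₁, P₂, Q] b₀ 0 1 * agg e ![d₁, d₂, d₃] J ![P₁, P₂, Q] a₀ 1 0 := by
  have hpair_ne : (a₀, b₀) ≠ (b₀, a₀) := fun h => hne₀ (Prod.mk.injEq _ _ _ _ ▸ h).1
  have hsub : ({(a₀, b₀), (b₀, a₀)} : Finset (ℕ × ℕ)) ⊆ antidiagonal n := by
    intro x hx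
    simp only [Finset.mem_insert, Finset.mem_singleton] at hx
    rw [Finset.HasAntidiagonal.mem_antidiagonal]
    rcases hx with rfl | rfl
    · exact hn
    · simp only; omega
  rw [coeff_det, ← Finset.sum_subset hsub]
  · rw [Finset.sum_pair hpair_ne]
    simp only
    ring
  · rintro ⟨a, b⟩ hab hnot
    have hab' : a + b = n := by simpa using hab
    simp only [Finset.mem_insert, Finset.mem_singleton, Prod.mk.injEq, not_or] at hnot
    simp only
    by_cases ha : ∃ l, expo e ![d₁, d₂, d₃] l = a
    · obtain ⟨l, hl⟩ := ha
      by_cases hb : ∃ l', expo e ![d₁, d₂, d₃] l' = b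
      · obtain ⟨l', hl'⟩ := hb
        rcases huniq l l' (by rw [hl, hl', hab']) with h | h
        · exact (hnot.1 ⟨hl.symm.trans h.1, hl'.symm.trans h.2⟩).elim
        · exact (hnot.2 ⟨hl.symm.trans h.1, hl'.symm.trans h.2⟩).elim
      · push Not at hb
        rw [agg_eq_zero e _ J _ b hb]
        simp
    · push Not at ha
      rw [agg_eq_zero e _ J _ a ha]
      simp

/-! ## 3. The coefficient table in the open chamber -/

section Table

/-- **COEFFICIENT TABLE of the W-determinant in the open chamber** (ten degrees, ten values; `J` and the letters any real
`2 × 2` matrices). -/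
theorem coeff_table (h₂₁ : d₂ < d₁) (h₁ₑ : d₁ < e) (hₑ₃ : e < d₃)
    (hc₁ : e + d₂ < 2 * d₁) (hc₂ : d₁ + e < d₂ + d₃) (hc₃ : d₂ + d₃ < 2 * e) :
    let F := Matrix.det (∑ l, ((X : ℝ[X]) ^ expo e ![d₁, d₂, d₃] l) • (letter J ![P₁, P₂, Q] l).map Polynomial.C)
    F.coeff (d₂ + d₂) = P₂.det ∧
    F.coeff (d₁ + d₂) = P₁ 0 0 * P₂ 1 1 + P₂ 0 0 * P₁ 1 1 - P₁ 0 1 * P₂ 1 0 - P₂ 0 1 * P₁ 1 0 ∧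
    F.coeff (e + d₂) = J 0 0 * P₂ 1 1 + P₂ 0 0 * J 1 1 - J 0 1 * P₂ 1 0 - P₂ 0 1 * J 1 0 ∧
    F.coeff (d₁ + d₁) = P₁.det ∧
    F.coeff (e + d₁) = J 0 0 * P₁ 1 1 + P₁ 0 0 * J 1 1 - J 0 1 * P₁ 1 0 - P₁ 0 1 * J 1 0 ∧
    F.coeff (d₂ + d₃) = P₂ 0 0 * Q 1 1 + Q 0 0 * P₂ 1 1 - P₂ 0 1 * Q 1 0 - Q 0 1 * P₂ 1 0 ∧
    F.coeff (e + e) = J.det ∧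
    F.coeff (d₁ + d₃) = P₁ 0 0 * Q 1 1 + Q 0 0 * P₁ 1 1 - P₁ 0 1 * Q 1 0 - Q 0 1 * P₁ 1 0 ∧
    F.coeff (e + d₃) = J 0 0 * Q 1 1 + Q 0 0 * J 1 1 - J 0 1 * Q 1 0 - Q 0 1 * J 1 0 ∧
    F.coeff (d₃ + d₃) = Q.det := by
  intro F
  obtain ⟨hP₂a, hP₁a, hJa, hQa⟩ := agg_w (J := J) (P₁ := P₁) (P₂ := P₂) (Q := Q) h₂₁ h₁ₑ hₑ₃
  have U : ∀ l : Option (Fin 3), expo e ![d₁, d₂, d₃] l = e ∨ expo e ![d₁, d₂, d₃] l = d₁ ∨ expo e ![d₁, d₂, d₃] l = d₂ ∨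
      expo e ![d₁, d₂, d₃] l = d₃ := fun l => expo_w_cases (e := e) (d₁ := d₁) (d₂ := d₂) (d₃ := d₃) l
  refine ⟨?_, ?_, ?_, ?_, ?_, ?_, ?_, ?_, ?_, ?_⟩
  · rw [← hP₂a]
    refine coeff_eq_square _ _ rfl fun l l' hs => ?_
    rcases U l with h | h | h | h <;> rcases U l' with h' | h' | h' | h' <;> rw [h, h'] at hs ⊢ <;> omega
  · rw [show d₁ + d₂ = d₁ + d₂ from rfl]
    have := coeff_eq_pair (J := J) (P₁ := P₁) (P₂ := P₂) (Q := Q) (e := e) (d₁ + d₂) d₁ d₂ rfl (by omega) fun l l' hs => by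
      rcases U l with h | h | h | h <;> rcases U l' with h' | h' | h' | h' <;> rw [h, h'] at hs ⊢ <;> omega
    rw [this, hP₁a, hP₂a]
  · have := coeff_eq_pair (J := J) (P₁ := P₁) (P₂ := P₂) (Q := Q) (e := e) (e + d₂) e d₂ rfl (by omega) fun l l' hs => by
      rcases U l with h | h | h | h <;> rcases U l' with h' | h' | h' | h' <;> rw [h, h'] at hs ⊢ <;> omega
    rw [this, hJa, hP₂a]
  · rw [← hP₁a]
    refine coeff_eq_square _ _ rfl fun l l' hs => ?_
    rcases U l with h | h | h | h <;> rcases U l' with h' | h' | h' | h' <;> rw [h, h'] at hs ⊢ <;> omega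
  · have := coeff_eq_pair (J := J) (P₁ := P₁) (P₂ := P₂) (Q := Q) (e := e) (e + d₁) e d₁ rfl (by omega) fun l l' hs => by
      rcases U l with h | h | h | h <;> rcases U l' with h' | h' | h' | h' <;> rw [h, h'] at hs ⊢ <;> omega
    rw [this, hJa, hP₁a]
  · have := coeff_eq_pair (J := J) (P₁ := P₁) (P₂ := P₂) (Q := Q) (e := e) (d₂ + d₃) d₂ d₃ rfl (by omega) fun l l' hs => by
      rcases U l with h | h | h | h <;> rcases U l' with h' | h' | h' | h' <;> rw [h, h'] at hs ⊢ <;> omega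
    rw [this, hP₂a, hQa]
  · rw [← hJa]
    refine coeff_eq_square _ _ rfl fun l l' hs => ?_
    rcases U l with h | h | h | h <;> rcases U l' with h' | h' | h' | h' <;> rw [h, h'] at hs ⊢ <;> omega
  · have := coeff_eq_pair (J := J) (P₁ := P₁) (P₂ := P₂) (Q := Q) (e := e) (d₁ + d₃) d₁ d₃ rfl (by omega) fun l l' hs => by
      rcases U l with h | h | h | h <;> rcases U l' with h' | h' | h' | h' <;> rw [h, h'] at hs ⊢ <;> omega
    rw [this, hP₁a, hQa]
  · have := coeff_eq_pair (J := J) (P₁ := P₁) (P₂ := P₂) (Q := Q) (e := e) (e + d₃) e d₃ rfl (by omega) fun l l' hs => by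
      rcases U l with h | h | h | h <;> rcases U l' with h' | h' | h' | h' <;> rw [h, h'] at hs ⊢ <;> omega
    rw [this, hJa, hQa]
  · rw [← hQa]
    refine coeff_eq_square _ _ rfl fun l l' hs => ?_
    rcases U l with h | h | h | h <;> rcases U l' with h' | h' | h' | h' <;> rw [h, h'] at hs ⊢ <;> omega

end Table

/-! ## 4. The lever and its Newton-like companions, in coefficient currency -/

/-- **LEVER (coefficients).**  In the open chamber, for `P₁` symmetric and `P₂, Q ⪰ 0`:
`coeff(2d₁) · coeff(d₂ + d₃) ≤ coeff(d₁ + d₂) · coeff(d₁ + d₃)` — the inner pair of positive coefficients is dominated by the outer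
pair (`WLawTwoSignCell.lever` with the middle letter `P₁` as the sandwich). -/
theorem lever_coeff (hP₁ : P₁.IsSymm) (hP₂ : P₂.PosSemidef) (hQ : Q.PosSemidef)
    (h₂₁ : d₂ < d₁) (h₁ₑ : d₁ < e) (hₑ₃ : e < d₃) (hc₁ : e + d₂ < 2 * d₁) (hc₂ : d₁ + e < d₂ + d₃) (hc₃ : d₂ + d₃ < 2 * e) :
    let F := Matrix.det (∑ l, ((X : ℝ[X]) ^ expo e ![d₁, d₂, d₃] l) • (letter J ![P₁, P₂, Q] l).map Polynomial.C)
    F.coeff (d₁ + d₁) * F.coeff (d₂ + d₃) ≤ F.coeff (d₁ + d₂) * F.coeff (d₁ + d₃) := by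
  intro F
  obtain ⟨_, h12, _, h11, _, h23, _, h13, _, _⟩ :=
    coeff_table (J := J) (P₁ := P₁) (P₂ := P₂) (Q := Q) h₂₁ h₁ₑ hₑ₃ hc₁ hc₂ hc₃
  change F.coeff (d₁ + d₂) = _ at h12
  change F.coeff (d₁ + d₁) = _ at h11
  change F.coeff (d₂ + d₃) = _ at h23
  change F.coeff (d₁ + d₃) = _ at h13
  rw [h11, h23, h12, h13]
  have hAs : P₁ 1 0 = P₁ 0 1 := hP₁.apply 0 1
  have hBs : P₂ 1 0 = P₂ 0 1 := (psd_two_facts hP₂).2.2.1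
  have hQs : Q 1 0 = Q 0 1 := (psd_two_facts hQ).2.2.1
  have h := WLawTwoSignCell.lever P₁ P₂ Q hP₁ hP₂ hQ
  rw [hAs, hBs, hQs]
  nlinarith [h]

/-- **Newton-like companion (low end).**  `coeff(2d₂) · coeff(d₁ + d₃) ≤ coeff(d₁ + d₂) · coeff(d₂ + d₃)` for `P₂` symmetric and
`P₁, Q ⪰ 0` (the lever with `P₂` as the sandwich; inner pair ≥ outer pair here, the Newton direction). -/
theorem newton_coeff_low (hP₂ : P₂.IsSymm) (hP₁ : P₁.PosSemidef) (hQ : Q.PosSemidef)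
    (h₂₁ : d₂ < d₁) (h₁ₑ : d₁ < e) (hₑ₃ : e < d₃) (hc₁ : e + d₂ < 2 * d₁) (hc₂ : d₁ + e < d₂ + d₃) (hc₃ : d₂ + d₃ < 2 * e) :
    let F := Matrix.det (∑ l, ((X : ℝ[X]) ^ expo e ![d₁, d₂, d₃] l) • (letter J ![P₁, P₂, Q] l).map Polynomial.C)
    F.coeff (d₂ + d₂) * F.coeff (d₁ + d₃) ≤ F.coeff (d₁ + d₂) * F.coeff (d₂ + d₃) := by
  intro F
  obtain ⟨h22, h12, _, _, _, h23, _, h13, _, _⟩ :=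
    coeff_table (J := J) (P₁ := P₁) (P₂ := P₂) (Q := Q) h₂₁ h₁ₑ hₑ₃ hc₁ hc₂ hc₃
  change F.coeff (d₂ + d₂) = _ at h22
  change F.coeff (d₁ + d₂) = _ at h12
  change F.coeff (d₂ + d₃) = _ at h23
  change F.coeff (d₁ + d₃) = _ at h13
  rw [h22, h23, h12, h13]
  have hBs : P₂ 1 0 = P₂ 0 1 := hP₂.apply 0 1
  have hAs : P₁ 1 0 = P₁ 0 1 := (psd_two_facts hP₁).2.2.1
  have hQs : Q 1 0 = Q 0 1 := (psd_two_facts hQ).2.2.1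
  have h := WLawTwoSignCell.lever P₂ P₁ Q hP₂ hP₁ hQ
  rw [hAs, hBs, hQs]
  nlinarith [h]

/-- **Newton-like companion (high end).**  `coeff(2d₃) · coeff(d₁ + d₂) ≤ coeff(d₂ + d₃) · coeff(d₁ + d₃)` for `Q` symmetric and
`P₁, P₂ ⪰ 0` (the lever with `Q` as the sandwich). -/
theorem newton_coeff_high (hQ : Q.IsSymm) (hP₁ : P₁.PosSemidef) (hP₂ : P₂.PosSemidef)
    (h₂₁ : d₂ < d₁) (h₁ₑ : d₁ < e) (hₑ₃ : e < d₃) (hc₁ : e + d₂ < 2 * d₁) (hc₂ : d₁ + e < d₂ + d₃) (hc₃ : d₂ + d₃ < 2 * e) :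
    let F := Matrix.det (∑ l, ((X : ℝ[X]) ^ expo e ![d₁, d₂, d₃] l) • (letter J ![P₁, P₂, Q] l).map Polynomial.C)
    F.coeff (d₃ + d₃) * F.coeff (d₁ + d₂) ≤ F.coeff (d₂ + d₃) * F.coeff (d₁ + d₃) := by
  intro F
  obtain ⟨_, h12, _, _, _, h23, _, h13, _, h33⟩ :=
    coeff_table (J := J) (P₁ := P₁) (P₂ := P₂) (Q := Q) h₂₁ h₁ₑ hₑ₃ hc₁ hc₂ hc₃
  change F.coeff (d₁ + d₂) = _ at h12
  change F.coeff (d₂ + d₃) = _ at h23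
  change F.coeff (d₁ + d₃) = _ at h13
  change F.coeff (d₃ + d₃) = _ at h33
  rw [h33, h23, h12, h13]
  have hQs : Q 1 0 = Q 0 1 := hQ.apply 0 1
  have hAs : P₁ 1 0 = P₁ 0 1 := (psd_two_facts hP₁).2.2.1
  have hBs : P₂ 1 0 = P₂ 0 1 := (psd_two_facts hP₂).2.2.1
  have h := WLawTwoSignCell.lever Q P₂ P₁ hQ hP₂ hP₁
  rw [hAs, hBs, hQs]
  nlinarith [h]

end WLawTwoCoefficients

end Summit.ValiantsHypothesis.ValiantsHypothesis.Theorems.LacunarySymmetroidMatrixDescartes
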